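import Literature.Topology.FourManifolds.BandSumDetourCurve
import Literature.Topology.FourManifolds.ConcordanceStripReplacement
import HarnessLib

/-!
# The detour of a band sum in a foliated chart, III: the detour datum

Topic `Literature/Topology/FourManifolds`; sequel of `BandSumDetourCurve.lean`. The periodised
connected-sum curve `KnotPiece.per` of part II, read in coordinates `(θ, d) ∈ ℝ × ℝ²`, is a
`StripFrame.Detour 0 η ε` (`ConcordanceStripReplacement.lean`) as soon as the chart and the small
knot fit in the tube of half-width `η/8` and radius `ε` around the core (`KnotPiece.TubeFit`):
`KnotPiece.detour`. Feeding it to `Knot.IsConicalConcordance.newKnot₁/newKnot₂/newAnnulus`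
produces the two band sums `K # K₂`, `K' # K₂` inside the tube of a conical concordance from `K`
to `K'`, together with a conical concordance between them. Everything here is proved.

## References

* R. H. Fox, J. W. Milnor, Osaka J. Math. 3 (1966), §1 (the consumer). [FoxMilnor1966]
-/

open Set Function Metric
open scoped Topology ContDiff

noncomputable section

namespace Literature.Topology.FourManifolds

namespace BandFoliation

open ChartData (e3)

/-- Local notation: `𝔼 n` is the model Euclidean space `EuclideanSpace ℝ (Fin n)`. -/
local notation "𝔼 " n:arg => EuclideanSpace ℝ (Fin n)

namespace KnotPiece

variable {C : ChartData} {D : SegData C} (P : KnotPiece C D)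

/-- **The chart and the small knot fit in the tube** of angular half-width `η/8` and radius `ε`
around the core: the doubled `θ`-interval of the chart lies in `[-η/8, η/8]`, the small knot has
`θ`-coordinates in `[-η/4, η/4]` and normal coordinates in the `ε`-ball, and twice the band height
`a` is below `ε` (so that the whole band neighbourhood fits). [folklore] -/
structure TubeFit (η ε : ℝ) : Prop where
  η_le : η ≤ 1
  lo : -(η / 8) ≤ C.θlo
  hi : C.θhi ≤ η / 8
  kθ : ∀ θ, P.k θ 0 ∈ Icc (-(η / 4)) (η / 4)
  kd : ∀ θ, (P.k θ 1, P.k θ 2) ∈ ball (0 : ℝ × ℝ) ε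
  two_a_lt : 2 * C.a < ε

namespace TubeFit

variable {P} {η ε : ℝ} (T : P.TubeFit η ε)
include T

/-- `0 < η`. [folklore] -/
theorem η_pos : 0 < η := by have := T.lo; have := T.hi; linarith [C.θlo_lt]

/-- `a < ε`. [folklore] -/
theorem a_lt : C.a < ε := by linarith [C.a_pos, T.two_a_lt]

/-- `0 < ε`. [folklore] -/
theorem ε_pos : 0 < ε := lt_trans C.a_pos T.a_lt

/-- `-1/4 < θlo`. [folklore] -/
theorem hlo : -(1 / 4 : ℝ) < C.θlo := by have := T.lo; have := T.η_le; linarith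

/-- `θhi < 1/4`. [folklore] -/
theorem hhi : C.θhi < 1 / 4 := by have := T.hi; have := T.η_le; linarith

/-- The `θ`-coordinates of the small knot lie in the period window. [folklore] -/
theorem hk (θ : ℝ) : P.k θ 0 ∈ Ico (C.θlo - 1 / 2) (C.θlo + 1 / 2) := by
  have h := T.kθ θ; have := T.lo; have := T.hi; have := T.η_le; have := C.θlo_lt
  exact ⟨by linarith [h.1], by linarith [h.2]⟩

/-- The arc `[-η/8, η/8]` lies in the period window. [folklore] -/
theorem arc_sub : Icc (-(η / 8)) (η / 8) ⊆ Ico (C.θlo - 1 / 2) (C.θlo + 1 / 2) := fun u hu ↦ by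
  have := T.lo; have := T.hi; have := T.η_le; have := C.θlo_lt
  exact ⟨by linarith [hu.1], by linarith [hu.2]⟩

end TubeFit

/-! ### Coordinates of the periodised detour -/

/-- The base angle `κθ u = per u 0`. [folklore] -/
def κθ (u : ℝ) : ℝ := P.per u 0

/-- The normal coordinates `κd u = (per u 1, per u 2)`. [folklore] -/
def κd (u : ℝ) : ℝ × ℝ := (P.per u 1, P.per u 2)

/-- Coordinates of `e₀`. [folklore] -/
@[simp] theorem e3_zero_apply (i : Fin 3) : (e3 0 : 𝔼 3) i = if i = 0 then 1 else 0 := by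
  simp [ChartData.e3, PiLp.single_apply]

/-- A coordinate of a `C^∞` curve in `ℝ³` is `C^∞`. [folklore] -/
theorem contDiff_apply {f : ℝ → 𝔼 3} (hf : ContDiff ℝ ∞ f) (i : Fin 3) : ContDiff ℝ ∞ fun u ↦ f u i :=
  contDiff_euclidean.1 hf i

/-- The derivative of a coordinate is the coordinate of the derivative. [folklore] -/
theorem deriv_apply {f : ℝ → 𝔼 3} (hf : ContDiff ℝ ∞ f) (i : Fin 3) (u : ℝ) :
    deriv (fun u ↦ f u i) u = deriv f u i := by
  have h : HasDerivAt f (deriv f u) u := ((hf.differentiable (by simp)) u).hasDerivAt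
  have h2 := ((PiLp.proj 2 (fun _ : Fin 3 ↦ ℝ) i).hasFDerivAt.comp_hasDerivAt u h).deriv
  simpa [Function.comp_def] using h2

variable {P} {η ε : ℝ} (T : P.TubeFit η ε)
include T

/-- `κθ` is `C^∞`. [folklore] -/
theorem contDiff_κθ : ContDiff ℝ ∞ P.κθ := contDiff_apply (P.contDiff_per T.hlo T.hhi) 0

/-- `κd` is `C^∞`. [folklore] -/
theorem contDiff_κd : ContDiff ℝ ∞ P.κd :=
  (contDiff_apply (P.contDiff_per T.hlo T.hhi) 1).prodMk (contDiff_apply (P.contDiff_per T.hlo T.hhi) 2)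

omit T in
/-- `κθ (u + 1) = κθ u + 1`. [folklore] -/
theorem κθ_add_one (u : ℝ) : P.κθ (u + 1) = P.κθ u + 1 := by
  simp [κθ, P.per_add_one]

omit T in
/-- `κd` has period `1`. [folklore] -/
theorem κd_periodic : Periodic P.κd 1 := fun u ↦ by
  simp [κd, P.per_add_one]

/-- **Away from the arc the detour is the core.** [folklore] -/
theorem id_of_not_inArc (u : ℝ) (hu : ¬ StripFrame.InArc (0 - η / 8) (0 + η / 8) u) :
    P.κθ u = u ∧ P.κd u = 0 := by
  rw [StripFrame.inArc_iff, not_exists] at hu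
  have hfar : ∀ m : ℤ, u - m ∉ Ioo C.θlo C.θhi := fun m h ↦ hu m
    ⟨by have := T.lo; linarith [h.1], by have := T.hi; linarith [h.2]⟩
  have he := P.per_eq_core hfar
  refine ⟨by rw [κθ, he, core_apply_zero], ?_⟩
  rw [κd, he, core_apply_one]
  simp [core]

/-- **On the arc the base angle stays in the doubled arc.** [folklore] -/
theorem mem_of_mem (u : ℝ) (hu : u ∈ Icc (0 - η / 8) (0 + η / 8)) : P.κθ u ∈ Icc (0 - η / 4) (0 + η / 4) := by
  rw [zero_sub, zero_add] at hu ⊢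
  have hη := T.η_pos
  rw [κθ, P.per_eq_curve (T.arc_sub hu)]
  rcases P.curve_cases u with h | ⟨x, -, hx1, h⟩ | ⟨θ, h⟩
  · rw [h, core_apply_zero]; exact ⟨by linarith [hu.1], by linarith [hu.2]⟩
  · rw [h]; have hB := B_zero_mem (C := C) hx1; have h1 := T.lo; have h2 := T.hi
    exact ⟨by linarith [hB.1], by linarith [hB.2]⟩
  · rw [h]; exact T.kθ θ

/-- **The normal coordinates stay in the `ε`-ball.** [folklore] -/
theorem mem_ball (u : ℝ) : P.κd u ∈ ball (0 : ℝ × ℝ) ε := by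
  have hε := T.ε_pos
  -- reduce to the window
  have hd : P.κd u = (P.curve (u - idx (C := C) u) 1, P.curve (u - idx (C := C) u) 2) := by
    simp [κd, per]
  rw [hd]
  rcases P.curve_cases (u - idx (C := C) u) with h | ⟨x, hx0, -, h⟩ | ⟨θ, h⟩
  · rw [h, core_apply_one]; simp [core, hε]
  · rw [h, ChartData.B_apply_one, ChartData.B_apply_two]
    obtain ⟨hF, -, -⟩ := F_facts (C := C) hx0
    rw [mem_ball_zero_iff, Prod.norm_mk, Real.norm_eq_abs, norm_zero, abs_of_nonneg hF.1, max_eq_left hF.1]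
    exact lt_of_le_of_lt hF.2 T.a_lt
  · rw [h]; exact T.kd θ

/-- **Injectivity modulo the period** (in fact injectivity). [folklore] -/
theorem inj (u u' : ℝ) (hθ : P.κθ u = P.κθ u') (hd : P.κd u = P.κd u') : ∃ m : ℤ, u' = u + m := by
  refine ⟨0, ?_⟩
  have : P.per u = P.per u' := by
    ext i; fin_cases i
    · exact hθ
    · exact congrArg Prod.fst hd
    · exact congrArg Prod.snd hd
  have := P.per_injective T.hlo T.hhi T.hk this
  simp [this]

/-- **Regularity.** [folklore] -/
theorem regular (u : ℝ) : deriv P.κθ u ≠ 0 ∨ deriv P.κd u ≠ 0 := by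
  have hper := P.contDiff_per T.hlo T.hhi
  have hne := P.deriv_per_ne_zero T.hlo T.hhi u
  by_contra h
  push Not at h
  obtain ⟨h0, h12⟩ := h
  have hd1 : HasDerivAt (fun u ↦ P.per u 1) (deriv P.per u 1) u := by
    rw [← deriv_apply hper 1 u]; exact ((contDiff_apply hper 1).differentiable (by simp) u).hasDerivAt
  have hd2 : HasDerivAt (fun u ↦ P.per u 2) (deriv P.per u 2) u := by
    rw [← deriv_apply hper 2 u]; exact ((contDiff_apply hper 2).differentiable (by simp) u).hasDerivAt
  have hκd : deriv P.κd u = (deriv P.per u 1, deriv P.per u 2) := (hd1.prodMk hd2).deriv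
  change deriv (fun u ↦ P.per u 0) u = 0 at h0
  rw [deriv_apply hper 0 u] at h0
  rw [hκd, Prod.mk_eq_zero] at h12
  apply hne
  ext i; fin_cases i
  · simpa using h0
  · simpa using h12.1
  · simpa using h12.2

/-- **The detour datum of the band sum**: the periodised connected-sum curve as a
`StripFrame.Detour 0 η ε`. [folklore] -/
def detour : StripFrame.Detour 0 η ε where
  κθ := P.κθ
  κd := P.κd
  contDiff_θ := contDiff_κθ T
  contDiff_d := contDiff_κd T
  add_one_θ := P.κθ_add_one
  periodic_d := P.κd_periodic
  id_of_not_inArc := id_of_not_inArc T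
  mem_of_mem := mem_of_mem T
  mem_ball := mem_ball T
  inj := inj T
  regular := regular T

/-- The base angle of the detour datum. [folklore] -/
@[simp] theorem detour_κθ : (detour T).κθ = P.κθ := rfl

/-- The normal coordinates of the detour datum. [folklore] -/
@[simp] theorem detour_κd : (detour T).κd = P.κd := rfl

/-- **On the window the detour datum reads the glued curve**: for `u ∈ [θlo - 1/2, θlo + 1/2)`,
`(κθ u, κd u)` are the coordinates of `curve u`. [folklore] -/
theorem detour_apply {u : ℝ} (hu : u ∈ Ico (C.θlo - 1 / 2) (C.θlo + 1 / 2)) :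
    (detour T).κθ u = P.curve u 0 ∧ (detour T).κd u = (P.curve u 1, P.curve u 2) := by
  simp [κθ, κd, P.per_eq_curve hu]

end KnotPiece

end BandFoliation

end Literature.Topology.FourManifolds
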